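import Summits.QuantumFields.YangMills.Theses.SqueezedSkewness
import HarnessLib

/-!
# Route `SqueezedSkewness` (LINE 2 «low-pass floor», ym-idea-6 g8) — the support `KLCoherence` (stmt-QuantumFields-22795)

Coherence of the Källén–Lehmann amplitudes of non-negative bumps at small lattice momentum: for `0 < s ≤ 1`, `μ ∈ [0,1]`,
`p ∈ ℝ³` with lattice momentum `(2/s²)Σᵢ(1 − cos(s pᵢ)) ≤ 1` and every Schwartz `f ≥ 0` with
`tsupport f ⊆ closedBall(2e₀, 1/2)`:
`½ · μ^{2⌊5/(2s)⌋} · (Σ_x f(sx))² ≤ ‖amp_s f(μ,p)‖²`, `amp_s f(μ,p) = Σ_x f(sx) μ^{x₀−1} e^{i s p·x⃗}`.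

Proof (the item's own sketch, pure real analysis): the lattice points charged by `f` have `x₀ ≤ ⌊5/(2s)⌋` and `|s x⃗| ≤ 1/2`, so
both series are finite sums over a box; each `pᵢ` is reduced modulo `(2π/s)ℤ` to `p̄ᵢ` with `|s p̄ᵢ| ≤ π` (the cosines and the
phases `e^{i s p·x⃗}`, `x⃗ ∈ ℤ³`, are unchanged); Jordan's inequality `1 − cos θ ≥ (2/π²)θ²` on `[−π, π]` (Mathlib `Real.cos_le_one_sub_mul_cos_sq`) gives `|p̄| ≤ π/2`, hence
every phase `s p̄·x⃗ ∈ [−π/4, π/4]` (Cauchy–Schwarz), so `Re amp ≥ (√2/2) μ^{⌊5/(2s)⌋} Σ_x f(sx) ≥ 0` and `‖amp‖² ≥ (Re amp)²`.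
Only this support item is proved; no summit / NT / mass-gap statement is proved here.
-/

set_option autoImplicit false

noncomputable section

namespace Summit.QuantumFields.YangMills.Theorems.KLCoherence

open scoped BigOperators
open Real Finset
open Literature.MathematicalPhysics.QuantumLattice (siteToE siteToE_apply)

/-! ## §1 Elementary trigonometry -/

/-- `cos θ ≥ √2/2` for `|θ| ≤ π/4`. [folklore] -/
theorem sqrt_two_div_two_le_cos {θ : ℝ} (hθ : |θ| ≤ π / 4) : Real.sqrt 2 / 2 ≤ Real.cos θ := by
  rw [← Real.cos_abs θ, ← Real.cos_pi_div_four]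
  exact Real.cos_le_cos_of_nonneg_of_le_pi (abs_nonneg θ) (by linarith [Real.pi_pos]) hθ

/-- Reduction of a momentum coordinate modulo `(2π/s)ℤ`: `p = q + (2π/s)·n` with `|s·q| ≤ π`. [folklore] -/
theorem exists_reduce_mod {s : ℝ} (hs : 0 < s) (p : ℝ) :
    ∃ (n : ℤ) (q : ℝ), p = q + 2 * π * n / s ∧ |s * q| ≤ π := by
  refine ⟨round (s * p / (2 * π)), p - 2 * π * (round (s * p / (2 * π)) : ℝ) / s, by ring, ?_⟩
  have hπ : 0 < π := Real.pi_pos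
  have h := abs_sub_round (s * p / (2 * π))
  have e : s * (p - 2 * π * (round (s * p / (2 * π)) : ℝ) / s) =
      2 * π * (s * p / (2 * π) - (round (s * p / (2 * π)) : ℝ)) := by
    field_simp
  rw [e, abs_mul, abs_of_pos (by positivity : (0 : ℝ) < 2 * π)]
  nlinarith

/-! ## §2 Lattice points charged by a bump of the high ball -/

/-- Coordinates of `s • siteToE x − 2e₀`. [folklore] -/
theorem coord_sub_single (s : ℝ) (x : Fin 4 → ℤ) (i : Fin 4) :
    (s • siteToE (d := 4) x - EuclideanSpace.single (0 : Fin 4) (2 : ℝ)) i =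
      s * (x i : ℝ) - if i = 0 then 2 else 0 := by
  simp [siteToE_apply]

/-- If `f(s·x) ≠ 0` for a bump `f` of the high ball `closedBall(2e₀, 1/2)`, then every coordinate of `x` is at most `3/s` in size,
the height is at most `5/(2s)`, and the spatial part has `Σₖ (s x_{k+1})² ≤ 1/4`. [folklore] -/
theorem bounds_of_apply_ne_zero {f : EuclideanSpace ℝ (Fin 4) → ℝ} {s : ℝ} (hs : 0 < s)
    (hsupp : tsupport f ⊆ Metric.closedBall (EuclideanSpace.single (0 : Fin 4) (2 : ℝ)) (1 / 2 : ℝ))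
    {x : Fin 4 → ℤ} (hx : f (s • siteToE (d := 4) x) ≠ 0) :
    (∀ i : Fin 4, |(x i : ℝ)| ≤ 3 / s) ∧ (x 0 : ℝ) ≤ 5 / (2 * s) ∧
      ∑ k : Fin 3, (s * (x k.succ : ℝ)) ^ 2 ≤ 1 / 4 := by
  set v : EuclideanSpace ℝ (Fin 4) := s • siteToE (d := 4) x - EuclideanSpace.single (0 : Fin 4) (2 : ℝ) with hv
  have hmem : s • siteToE (d := 4) x ∈ tsupport f := subset_tsupport _ (Function.mem_support.2 hx)
  have hball := hsupp hmem
  rw [Metric.mem_closedBall, dist_eq_norm] at hball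
  have hvi : ∀ i : Fin 4, |s * (x i : ℝ) - if i = 0 then 2 else 0| ≤ 1 / 2 := by
    intro i
    have h := PiLp.norm_apply_le v i
    rw [Real.norm_eq_abs, hv, coord_sub_single] at h
    exact h.trans hball
  refine ⟨fun i => ?_, ?_, ?_⟩
  · -- `|s x_i| ≤ 1/2 + 2`, hence `|x_i| ≤ 5/(2s) ≤ 3/s`
    have h := hvi i
    have h2 : |s * (x i : ℝ)| ≤ 5 / 2 := by
      have htri : |s * (x i : ℝ)| ≤ |s * (x i : ℝ) - if i = 0 then 2 else 0| + |(if i = 0 then (2 : ℝ) else 0)| := by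
        have := abs_add_le (s * (x i : ℝ) - if i = 0 then 2 else 0) (if i = 0 then (2 : ℝ) else 0)
        rwa [sub_add_cancel] at this
      have h3 : |(if i = 0 then (2 : ℝ) else 0)| ≤ 2 := by split_ifs <;> norm_num
      linarith
    rw [abs_mul, abs_of_pos hs] at h2
    rw [le_div_iff₀ hs]
    nlinarith
  · have h := hvi 0
    simp only [if_true] at h
    have h2 := (abs_le.1 h).2
    rw [le_div_iff₀ (by positivity)]
    nlinarith
  · -- the spatial coordinates of `v` are `s x_{k+1}`, and `Σᵢ vᵢ² = ‖v‖² ≤ 1/4`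
    have hnorm : ‖v‖ ^ 2 = ∑ i : Fin 4, ‖v i‖ ^ 2 := PiLp.norm_sq_eq_of_L2 _ v
    have hsq : ‖v‖ ^ 2 ≤ (1 / 2 : ℝ) ^ 2 := pow_le_pow_left₀ (norm_nonneg _) hball 2
    rw [hnorm, Fin.sum_univ_succ] at hsq
    have hcoord : ∀ k : Fin 3, ‖v k.succ‖ ^ 2 = (s * (x k.succ : ℝ)) ^ 2 := by
      intro k
      rw [hv, coord_sub_single, Real.norm_eq_abs, sq_abs, if_neg (Fin.succ_ne_zero k), sub_zero]
    simp only [hcoord] at hsq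
    have h0 : 0 ≤ ‖v 0‖ ^ 2 := by positivity
    have h1 : ∑ k : Fin 3, (s * (x k.succ : ℝ)) ^ 2 ≤ (1 / 2 : ℝ) ^ 2 := by linarith
    norm_num at h1
    exact h1

/-! ## §3 The route item -/

/-- **`SqueezedSkewness.KLCoherence` (stmt-QuantumFields-22795) holds.** Coherence of the Källén–Lehmann amplitudes of
non-negative bumps of the high ball at small lattice momentum:
`½ μ^{2⌊5/(2s)⌋} (Σ_x f(sx))² ≤ ‖Σ_x f(sx) μ^{x₀−1} e^{i s p·x⃗}‖²`.  Pure real analysis (finite sums, reduction mod `(2π/s)ℤ³`,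
Jordan's inequality, Cauchy–Schwarz); no summit / NT / mass-gap statement is proved. [cite: MontvayMunster1994, §1.3 (Källén–Lehmann representation on the lattice; bookkeeping)] -/
theorem klCoherence_proof : Summit.QuantumFields.YangMills.Theses.SqueezedSkewness.KLCoherence := by
  intro s μ p f hs hs1 hμ0 hμ1 hf hsupp hmom
  dsimp only
  have hπ : 0 < π := Real.pi_pos
  -- (0) the charged lattice points lie in a finite box
  set N : ℕ := ⌈3 / s⌉₊ with hN
  set box : Finset (Fin 4 → ℤ) := Fintype.piFinset fun _ : Fin 4 => Finset.Icc (-(N : ℤ)) N with hbox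
  have hmemBox : ∀ x : Fin 4 → ℤ, f (s • siteToE (d := 4) x) ≠ 0 → x ∈ box := by
    intro x hx
    obtain ⟨hc, -, -⟩ := bounds_of_apply_ne_zero (f := f) hs hsupp hx
    rw [hbox, Fintype.mem_piFinset]
    intro i
    have hi := hc i
    have hN' : 3 / s ≤ (N : ℝ) := Nat.le_ceil _
    have habs := abs_le.1 (hi.trans hN')
    rw [Finset.mem_Icc]
    constructor
    · have : (-(N : ℤ) : ℝ) ≤ (x i : ℝ) := by push_cast; linarith [habs.1]
      exact_mod_cast this
    · have : (x i : ℝ) ≤ ((N : ℤ) : ℝ) := by push_cast; linarith [habs.2]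
      exact_mod_cast this
  have hzero : ∀ x : Fin 4 → ℤ, x ∉ box → f (s • siteToE (d := 4) x) = 0 :=
    fun x hx => by_contra fun h => hx (hmemBox x h)
  -- (1) both series are finite sums over the box
  have hS : ∑' x : Fin 4 → ℤ, f (s • siteToE (d := 4) x) = ∑ x ∈ box, f (s • siteToE (d := 4) x) :=
    tsum_eq_sum (fun x hx => hzero x hx)
  set amp : ℂ := ∑' x : Fin 4 → ℤ, (((f (s • siteToE (d := 4) x) * μ ^ (Int.toNat (x 0 - 1))) : ℝ) : ℂ) *
      Complex.exp (Complex.I * ((s * ∑ k : Fin 3, p k * (x k.succ : ℝ) : ℝ) : ℂ)) with hamp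
  have hA : amp = ∑ x ∈ box, (((f (s • siteToE (d := 4) x) * μ ^ (Int.toNat (x 0 - 1))) : ℝ) : ℂ) *
      Complex.exp (Complex.I * ((s * ∑ k : Fin 3, p k * (x k.succ : ℝ) : ℝ) : ℂ)) := by
    rw [hamp]
    exact tsum_eq_sum (fun x hx => by simp [hzero x hx])
  -- (2) reduction of the momentum modulo `(2π/s)ℤ³`
  have hred : ∀ k : Fin 3, ∃ (n : ℤ) (q : ℝ), p k = q + 2 * π * n / s ∧ |s * q| ≤ π :=
    fun k => exists_reduce_mod hs (p k)
  choose n q hpq hq using hred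
  -- the lattice momentum is unchanged, so `Σ (s qₖ)² ≤ π² s²/4` by Jordan
  have hcos : ∀ k : Fin 3, Real.cos (s * p k) = Real.cos (s * q k) := by
    intro k
    rw [hpq k, show s * (q k + 2 * π * (n k : ℝ) / s) = s * q k + (n k : ℝ) * (2 * π) by field_simp]
    exact Real.cos_add_int_mul_two_pi _ _
  have hq2 : ∑ k : Fin 3, (s * q k) ^ 2 ≤ π ^ 2 * s ^ 2 / 4 := by
    have hj : ∀ k : Fin 3, (s * q k) ^ 2 ≤ π ^ 2 / 2 * (1 - Real.cos (s * p k)) := by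
      intro k
      rw [hcos k]
      have h0 : 2 / π ^ 2 * (s * q k) ^ 2 ≤ 1 - Real.cos (s * q k) := by
        linarith [Real.cos_le_one_sub_mul_cos_sq (hq k)]
      have h1 : π ^ 2 / 2 * (2 / π ^ 2 * (s * q k) ^ 2) ≤ π ^ 2 / 2 * (1 - Real.cos (s * q k)) :=
        mul_le_mul_of_nonneg_left h0 (by positivity)
      have e : π ^ 2 / 2 * (2 / π ^ 2 * (s * q k) ^ 2) = (s * q k) ^ 2 := by
        field_simp
      linarith
    have hsum : ∑ k : Fin 3, (1 - Real.cos (s * p k)) ≤ s ^ 2 / 2 := by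
      have h1 : s ^ 2 / 2 * (2 / s ^ 2 * ∑ i : Fin 3, (1 - Real.cos (s * p i))) ≤ s ^ 2 / 2 * 1 :=
        mul_le_mul_of_nonneg_left hmom (by positivity)
      have e : s ^ 2 / 2 * (2 / s ^ 2 * ∑ i : Fin 3, (1 - Real.cos (s * p i))) =
          ∑ i : Fin 3, (1 - Real.cos (s * p i)) := by
        field_simp
      linarith
    calc ∑ k : Fin 3, (s * q k) ^ 2 ≤ ∑ k : Fin 3, π ^ 2 / 2 * (1 - Real.cos (s * p k)) := Finset.sum_le_sum fun k _ => hj k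
      _ = π ^ 2 / 2 * ∑ k : Fin 3, (1 - Real.cos (s * p k)) := by rw [Finset.mul_sum]
      _ ≤ π ^ 2 / 2 * (s ^ 2 / 2) := mul_le_mul_of_nonneg_left hsum (by positivity)
      _ = π ^ 2 * s ^ 2 / 4 := by ring
  -- (3) the real part of every term dominates `(√2/2) μ^E f(sx)`
  set E : ℕ := ⌊5 / (2 * s)⌋₊ with hE
  have hterm : ∀ x : Fin 4 → ℤ,
      Real.sqrt 2 / 2 * μ ^ E * f (s • siteToE (d := 4) x) ≤
        ((((f (s • siteToE (d := 4) x) * μ ^ (Int.toNat (x 0 - 1))) : ℝ) : ℂ) *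
          Complex.exp (Complex.I * ((s * ∑ k : Fin 3, p k * (x k.succ : ℝ) : ℝ) : ℂ))).re := by
    intro x
    -- the real part is `f(sx) μ^{e} cos θ`
    have hre : ((((f (s • siteToE (d := 4) x) * μ ^ (Int.toNat (x 0 - 1))) : ℝ) : ℂ) *
          Complex.exp (Complex.I * ((s * ∑ k : Fin 3, p k * (x k.succ : ℝ) : ℝ) : ℂ))).re =
        f (s • siteToE (d := 4) x) * μ ^ (Int.toNat (x 0 - 1)) *
          Real.cos (s * ∑ k : Fin 3, p k * (x k.succ : ℝ)) := by
      rw [Complex.re_ofReal_mul, Complex.exp_re]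
      simp [Complex.mul_re, Complex.mul_im, Complex.I_re, Complex.I_im, Complex.ofReal_re, Complex.ofReal_im]
    rw [hre]
    by_cases hfx : f (s • siteToE (d := 4) x) = 0
    · simp [hfx]
    obtain ⟨-, hx0, hsp⟩ := bounds_of_apply_ne_zero (f := f) hs hsupp hfx
    have hfx0 : 0 < f (s • siteToE (d := 4) x) := lt_of_le_of_ne (hf _) (Ne.symm hfx)
    -- the exponent: `toNat (x₀ − 1) ≤ E`
    have hex : Int.toNat (x 0 - 1) ≤ E := by
      rw [Int.toNat_le]
      have hlt : (5 : ℝ) / (2 * s) < (E : ℝ) + 1 := Nat.lt_floor_add_one _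
      have h1 : ((x 0 : ℤ) : ℝ) < (E : ℝ) + 1 := lt_of_le_of_lt hx0 hlt
      have h2 : (x 0 : ℤ) < (E : ℤ) + 1 := by exact_mod_cast h1
      omega
    have hμpow : μ ^ E ≤ μ ^ (Int.toNat (x 0 - 1)) := pow_le_pow_of_le_one hμ0 hμ1 hex
    -- the phase: `cos θ = cos θ̄` with `|θ̄| ≤ π/4`
    have hphase : Real.cos (s * ∑ k : Fin 3, p k * (x k.succ : ℝ)) =
        Real.cos (∑ k : Fin 3, q k * (s * (x k.succ : ℝ))) := by
      have e : s * ∑ k : Fin 3, p k * (x k.succ : ℝ) =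
          ∑ k : Fin 3, q k * (s * (x k.succ : ℝ)) + ((∑ k : Fin 3, n k * x k.succ : ℤ) : ℝ) * (2 * π) := by
        push_cast
        rw [Finset.mul_sum, Finset.sum_mul, ← Finset.sum_add_distrib]
        refine Finset.sum_congr rfl fun k _ => ?_
        rw [hpq k]
        field_simp
      rw [e]
      exact Real.cos_add_int_mul_two_pi _ _
    have hθ : |∑ k : Fin 3, q k * (s * (x k.succ : ℝ))| ≤ π / 4 := by
      have hcs : (∑ k : Fin 3, q k * (s * (x k.succ : ℝ))) ^ 2 ≤
          (∑ k : Fin 3, q k ^ 2) * ∑ k : Fin 3, (s * (x k.succ : ℝ)) ^ 2 :=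
        Finset.sum_mul_sq_le_sq_mul_sq _ _ _
      have hq2' : ∑ k : Fin 3, q k ^ 2 ≤ π ^ 2 / 4 := by
        have e : ∑ k : Fin 3, (s * q k) ^ 2 = s ^ 2 * ∑ k : Fin 3, q k ^ 2 := by
          rw [Finset.mul_sum]; exact Finset.sum_congr rfl fun k _ => by ring
        rw [e] at hq2
        have hs2 : 0 < s ^ 2 := by positivity
        have : s ^ 2 * ∑ k : Fin 3, q k ^ 2 ≤ s ^ 2 * (π ^ 2 / 4) := by nlinarith
        exact le_of_mul_le_mul_left this hs2
      have hb : (∑ k : Fin 3, q k * (s * (x k.succ : ℝ))) ^ 2 ≤ (π / 4) ^ 2 := by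
        calc (∑ k : Fin 3, q k * (s * (x k.succ : ℝ))) ^ 2
            ≤ (∑ k : Fin 3, q k ^ 2) * ∑ k : Fin 3, (s * (x k.succ : ℝ)) ^ 2 := hcs
          _ ≤ (π ^ 2 / 4) * (1 / 4) :=
              mul_le_mul hq2' hsp (Finset.sum_nonneg fun k _ => sq_nonneg _) (by positivity)
          _ = (π / 4) ^ 2 := by ring
      have h := Real.sqrt_le_sqrt hb
      rwa [Real.sqrt_sq_eq_abs, Real.sqrt_sq (by positivity)] at h
    have hcosθ : Real.sqrt 2 / 2 ≤ Real.cos (s * ∑ k : Fin 3, p k * (x k.succ : ℝ)) := by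
      rw [hphase]; exact sqrt_two_div_two_le_cos hθ
    have h22 : 0 ≤ Real.sqrt 2 / 2 := by positivity
    have hμE : 0 ≤ μ ^ E := pow_nonneg hμ0 _
    calc Real.sqrt 2 / 2 * μ ^ E * f (s • siteToE (d := 4) x)
        = f (s • siteToE (d := 4) x) * (μ ^ E * (Real.sqrt 2 / 2)) := by ring
      _ ≤ f (s • siteToE (d := 4) x) * (μ ^ (Int.toNat (x 0 - 1)) * Real.cos (s * ∑ k : Fin 3, p k * (x k.succ : ℝ))) :=
          mul_le_mul_of_nonneg_left (mul_le_mul hμpow hcosθ h22 (pow_nonneg hμ0 _)) hfx0.le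
      _ = f (s • siteToE (d := 4) x) * μ ^ (Int.toNat (x 0 - 1)) * Real.cos (s * ∑ k : Fin 3, p k * (x k.succ : ℝ)) := by
          ring
  -- (4) sum up: `Re amp ≥ (√2/2) μ^E Σ f ≥ 0`, and `‖amp‖² ≥ (Re amp)²`
  have hRe : Real.sqrt 2 / 2 * μ ^ E * ∑ x ∈ box, f (s • siteToE (d := 4) x) ≤ amp.re := by
    rw [hA, Complex.re_sum, Finset.mul_sum]
    exact Finset.sum_le_sum fun x _ => hterm x
  have hm0 : 0 ≤ Real.sqrt 2 / 2 * μ ^ E * ∑ x ∈ box, f (s • siteToE (d := 4) x) := by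
    have : 0 ≤ ∑ x ∈ box, f (s • siteToE (d := 4) x) := Finset.sum_nonneg fun x _ => hf _
    positivity
  have hsq : (Real.sqrt 2 / 2 * μ ^ E * ∑ x ∈ box, f (s • siteToE (d := 4) x)) ^ 2 ≤ ‖amp‖ ^ 2 := by
    have h1 : (Real.sqrt 2 / 2 * μ ^ E * ∑ x ∈ box, f (s • siteToE (d := 4) x)) ^ 2 ≤ (amp.re) ^ 2 :=
      pow_le_pow_left₀ hm0 hRe 2
    have h2 : (amp.re) ^ 2 ≤ ‖amp‖ ^ 2 := by
      rw [← sq_abs]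
      exact pow_le_pow_left₀ (abs_nonneg _) (Complex.abs_re_le_norm _) 2
    exact h1.trans h2
  rw [hS]
  have e2 : (Real.sqrt 2 / 2 * μ ^ E * ∑ x ∈ box, f (s • siteToE (d := 4) x)) ^ 2 =
      (1 / 2 : ℝ) * μ ^ (2 * E) * (∑ x ∈ box, f (s • siteToE (d := 4) x)) ^ 2 := by
    have h2 : Real.sqrt 2 ^ 2 = 2 := Real.sq_sqrt (by norm_num)
    rw [mul_pow, mul_pow, div_pow, h2, ← pow_mul, mul_comm E 2]
    ring
  rw [e2] at hsq
  exact hsq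

end Summit.QuantumFields.YangMills.Theorems.KLCoherence

end
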